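import Literature.AlgebraicGeometry.FormalGeometry.TowerModuleCokernel
import HarnessLib

/-!
# Base change of modules over a tower along a morphism of towers (GW Constr. 24.104, `π^*`)

Görtz–Wedhorn, *Algebraic Geometry II* (2023), §(24.21), Construction 24.104 (p. 571): for a
morphism `π : X' → X` of schemes and the induced morphisms of infinitesimal neighbourhoods
`π_n : Z'_n = π⁻¹(Z_n) → Z_n`, "for every `𝒪_{X_{/Z}}`-module `ℱ = (ℱ_n)_n` the pullback `π^*ℱ` [is]
the `𝒪_{X'_{/Z'}}`-module `(π_n^* ℱ_n)_n`" — the structure isomorphisms being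
`ι'_n{}^* π_{n+1}^* ℱ_{n+1} ≅ π_n^* ι_n^* ℱ_{n+1} ≅ π_n^* ℱ_n` (`ι'_n ≫ π_{n+1} = π_n ≫ ι_n`).

For modules over ARBITRARY towers (`Literature.AlgebraicGeometry.FormalGeometry.TowerModule`) and a
morphism of towers `f n : Y' n ⟶ Y n` with `t' n ≫ f (n+1) = f n ≫ t n` this file constructs

* `TowerModule.baseChangeIso f hf n : (f (n+1))^* ⋙ (t' n)^* ≅ (t n)^* ⋙ (f n)^*` (pseudofunctoriality
  of inverse images, Mathlib `Scheme.Modules.pullbackComp` / `pullbackCongr`) and its components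
  `baseChangeIsoApp` with their naturality;
* **`TowerModule.baseChange f hf : ((Y_n)_n-Mod) ⥤ ((Y'_n)_n-Mod)`, `ℱ ↦ (f_n^* ℱ_n)_n`** (Constr.
  24.104), with `rfl` computation rules, additivity, and
  `baseChange_isVectorBundle` (base change of a locally free module over the tower is locally free —
  inverse images of vector bundles are vector bundles, Stacks 01C8);
* `baseChangeCokernelIsoCokernelObj` / `baseChangeCokernelIso`: **base change commutes with
  cokernels**, `f^*(Coker u) ≅ Coker(f^* u)` in `((Y'_n)_n-Mod)` (each `(f n)^*` is a left adjoint;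
  cokernels of modules over a tower are level-wise, GW Rem. 24.92 /
  `Literature.AlgebraicGeometry.FormalGeometry.TowerModuleCokernel`).

* `baseChangeCompletionObjIso`: level by level, `f^*(ℱ_{/Z})_n ≅ ((g^*ℱ)_{/Z'})_n` for a
  commutative square of towers under `g : X' ⟶ X` ("`π^*(ℱ_{/Z}) = (π^*ℱ)_{/Z'}`", loc. cit.).

## Not here

The comparison `f^*(ℱ_{/Z}) ≅ (g^*ℱ)_{/Z'}` AS MODULES OVER THE TOWER (compatibility of the
level-wise isomorphisms with the structure isomorphisms needs the associativity coherence of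
`pullbackComp`, Mathlib `Scheme.Modules.pseudofunctor_associativity`), composition / identity of
base changes, and the direct image `π_*` of Constr. 24.104 (which needs `π` flat or a finiteness
argument, loc. cit.).

## References

* U. Görtz, T. Wedhorn, *Algebraic Geometry II: Cohomology of Schemes*, Springer Spektrum 2023,
  Def. 24.85 (p. 561), Remark 24.92 (p. 565), Construction 24.104 (p. 571). [GortzWedhorn2023]
-/

noncomputable section

open CategoryTheory CategoryTheory.Limits

namespace Literature.AlgebraicGeometry.FormalGeometry

open _root_.AlgebraicGeometry

universe u

namespace TowerModule

variable {Y : ℕ → Scheme.{u}} {t : ∀ n, Y n ⟶ Y (n + 1)}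
  {Y' : ℕ → Scheme.{u}} {t' : ∀ n, Y' n ⟶ Y' (n + 1)}
  (f : ∀ n, Y' n ⟶ Y n) (hf : ∀ n, t' n ≫ f (n + 1) = f n ≫ t n)

/-! ### The base-change isomorphisms `(t' n)^* (f (n+1))^* ≅ (f n)^* (t n)^*` -/

/-- **The base-change isomorphism of a morphism of towers**:
`(f (n+1))^* ⋙ (t' n)^* ≅ (t' n ≫ f (n+1))^* = (f n ≫ t n)^* ≅ (t n)^* ⋙ (f n)^*`
(pseudofunctoriality of inverse images of modules, Mathlib `Scheme.Modules.pullbackComp` and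
`Scheme.Modules.pullbackCongr`). [folklore] -/
def baseChangeIso (n : ℕ) :
    Scheme.Modules.pullback (f (n + 1)) ⋙ Scheme.Modules.pullback (t' n) ≅
      Scheme.Modules.pullback (t n) ⋙ Scheme.Modules.pullback (f n) :=
  Scheme.Modules.pullbackComp (t' n) (f (n + 1)) ≪≫ Scheme.Modules.pullbackCongr (hf n) ≪≫
    (Scheme.Modules.pullbackComp (f n) (t n)).symm

/-- The component of `baseChangeIso` at a module `ℳ` on `Y (n+1)`, with its source and target
written out: `(t' n)^* (f (n+1))^* ℳ ≅ (f n)^* (t n)^* ℳ`. [folklore] -/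
def baseChangeIsoApp (n : ℕ) (M : (Y (n + 1)).Modules) :
    (Scheme.Modules.pullback (t' n)).obj ((Scheme.Modules.pullback (f (n + 1))).obj M) ≅
      (Scheme.Modules.pullback (f n)).obj ((Scheme.Modules.pullback (t n)).obj M) :=
  (baseChangeIso f hf n).app M

/-- Naturality of `baseChangeIsoApp` in the module. [folklore] -/
@[reassoc]
theorem baseChangeIsoApp_naturality (n : ℕ) {M M' : (Y (n + 1)).Modules} (φ : M ⟶ M') :
    (Scheme.Modules.pullback (t' n)).map ((Scheme.Modules.pullback (f (n + 1))).map φ) ≫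
        (baseChangeIsoApp f hf n M').hom =
      (baseChangeIsoApp f hf n M).hom ≫
        (Scheme.Modules.pullback (f n)).map ((Scheme.Modules.pullback (t n)).map φ) :=
  (baseChangeIso f hf n).hom.naturality φ

/-! ### GW Construction 24.104: the inverse image `ℱ ↦ (f_n^* ℱ_n)_n` -/

/-- **Görtz–Wedhorn II, Construction 24.104: base change (inverse image) of modules over a tower
along a morphism of towers**, `ℱ = (ℱ_n)_n ↦ f^*ℱ := (f_n^* ℱ_n)_n`, with structure isomorphisms
`(t' n)^* f_{n+1}^* ℱ_{n+1} ≅ f_n^* (t n)^* ℱ_{n+1} ≅ f_n^* ℱ_n` (`baseChangeIsoApp`, then `f_n^*` of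
the structure isomorphism of `ℱ`), acting on morphisms by `u ↦ (f_n^* u_n)_n` (a morphism of
modules over `(Y'_n)_n` by the naturality of `baseChangeIsoApp` and functoriality of `f_n^*`).
In print `f n = π_n : Z'_n = π⁻¹(Z_n) → Z_n` for a morphism of schemes `π : X' → X`.
[cite: GortzWedhorn2023, Construction 24.104 (p. 571)] -/
def baseChange : TowerModule Y t ⥤ TowerModule Y' t' where
  obj E :=
    { obj := fun n => (Scheme.Modules.pullback (f n)).obj (E.obj n)
      iso := fun n => baseChangeIsoApp f hf n (E.obj (n + 1)) ≪≫
        (Scheme.Modules.pullback (f n)).mapIso (E.iso n) }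
  map φ :=
    { app := fun n => (Scheme.Modules.pullback (f n)).map (φ.app n)
      comm := fun n => by
        rw [Iso.trans_hom, Iso.trans_hom, Functor.mapIso_hom, Functor.mapIso_hom,
          baseChangeIsoApp_naturality_assoc, Category.assoc, ← CategoryTheory.Functor.map_comp,
          ← CategoryTheory.Functor.map_comp, φ.comm] }
  map_id E := hom_ext fun n => (Scheme.Modules.pullback (f n)).map_id _
  map_comp φ ψ := hom_ext fun n => (Scheme.Modules.pullback (f n)).map_comp _ _

/-- The levels of the base change: `(f^*ℱ)_n = f_n^* ℱ_n` (by `rfl`). [folklore] -/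
@[simp]
theorem baseChange_obj_obj (E : TowerModule Y t) (n : ℕ) :
    ((baseChange f hf).obj E).obj n = (Scheme.Modules.pullback (f n)).obj (E.obj n) := rfl

/-- The structure isomorphisms of the base change (by `rfl`). [folklore] -/
theorem baseChange_obj_iso (E : TowerModule Y t) (n : ℕ) :
    ((baseChange f hf).obj E).iso n =
      baseChangeIsoApp f hf n (E.obj (n + 1)) ≪≫ (Scheme.Modules.pullback (f n)).mapIso (E.iso n) :=
  rfl

/-- The base change on morphisms: `(f^*u)_n = f_n^* u_n` (by `rfl`). [folklore] -/
@[simp]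
theorem baseChange_map_app {E E' : TowerModule Y t} (φ : E ⟶ E') (n : ℕ) :
    ((baseChange f hf).map φ).app n = (Scheme.Modules.pullback (f n)).map (φ.app n) := rfl

/-- Base change followed by the `n`-th level is the `n`-th level followed by `f_n^*` (by `rfl`).
[folklore] -/
theorem baseChange_comp_eval (n : ℕ) :
    baseChange f hf ⋙ eval Y' t' n = eval Y t n ⋙ Scheme.Modules.pullback (f n) := rfl

/-- **Base change is additive** (each `f_n^*` is). [folklore] -/
instance baseChange_additive : (baseChange f hf).Additive where
  map_add := hom_ext fun n => (Scheme.Modules.pullback (f n)).map_add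

/-- **The base change of a locally free module (of finite type) over a tower is locally free**:
level-wise, inverse images of vector bundles are vector bundles (Stacks 01C8,
`IsVectorBundle.pullback`). This is the step "`π^*ℱ` is a finite locally free `𝒪_{X'_{/Z'}}`-module"
of the dévissage (GW (24.21), proof of Thm. 24.94 in the proper case).
[cite: GortzWedhorn2023, Construction 24.104 (p. 571)] -/
theorem baseChange_isVectorBundle {E : TowerModule Y t} (h : E.IsVectorBundle) :
    ((baseChange f hf).obj E).IsVectorBundle :=
  fun n => (h n).pullback (f n)

/-- Base change transports isomorphic modules over the tower to isomorphic ones (functoriality;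
recorded for use with `ofNonemptyIso`). [folklore] -/
theorem nonempty_iso_baseChange_of_nonempty_iso {E E' : TowerModule Y t} (h : Nonempty (E ≅ E')) :
    Nonempty ((baseChange f hf).obj E ≅ (baseChange f hf).obj E') :=
  h.map (baseChange f hf).mapIso

/-! ### Base change commutes with cokernels -/

section Cokernel

variable {E E' : TowerModule Y t} (u : E ⟶ E')

/-- **`f^*(Coker u) ≅ Coker(f^* u)`, level-wise form**: the base change of the level-wise cokernel
`(Coker(u_n))_n` (GW Rem. 24.92) is the level-wise cokernel of `f^*u` — each `f_n^*` is a left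
adjoint, hence preserves cokernels (`PreservesCokernel.iso`), compatibly with the structure
isomorphisms (naturality of `baseChangeIsoApp` and of the cokernel comparison).
[cite: GortzWedhorn2023, Remark 24.92 (p. 565) and Construction 24.104 (p. 571)] -/
def baseChangeCokernelIsoCokernelObj :
    (baseChange f hf).obj (cokernelObj u) ≅ cokernelObj ((baseChange f hf).map u) :=
  isoMk (fun n => PreservesCokernel.iso (Scheme.Modules.pullback (f n)) (u.app n)) fun n => by
    refine (cancel_epi ((Scheme.Modules.pullback (t' n)).map
      ((Scheme.Modules.pullback (f (n + 1))).map (cokernel.π (u.app (n + 1)))))).1 ?_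
    -- the structure square of `cokernelπ u`, written out
    have ck : (Scheme.Modules.pullback (t n)).map (cokernel.π (u.app (n + 1))) ≫
        ((cokernelObj u).iso n).hom = (E'.iso n).hom ≫ cokernel.π (u.app n) :=
      (cokernelπ u).comm n
    -- left-hand side: through `Coker((t' n)^* f_{n+1}^* u_{n+1})`
    have lhs : (Scheme.Modules.pullback (t' n)).map
          ((Scheme.Modules.pullback (f (n + 1))).map (cokernel.π (u.app (n + 1)))) ≫
        (Scheme.Modules.pullback (t' n)).map
          (PreservesCokernel.iso (Scheme.Modules.pullback (f (n + 1))) (u.app (n + 1))).hom ≫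
        ((cokernelObj ((baseChange f hf).map u)).iso n).hom =
        (((baseChange f hf).obj E').iso n).hom ≫
          cokernel.π ((Scheme.Modules.pullback (f n)).map (u.app n)) := by
      rw [← CategoryTheory.Functor.map_comp_assoc, PreservesCokernel.π_iso_hom]
      exact (cokernelπ ((baseChange f hf).map u)).comm n
    -- right-hand side: naturality of `baseChangeIsoApp` at `coker.π u_{n+1}`, then `ck`
    have key : (Scheme.Modules.pullback (f n)).map
          ((Scheme.Modules.pullback (t n)).map (cokernel.π (u.app (n + 1)))) ≫
        (Scheme.Modules.pullback (f n)).map ((cokernelObj u).iso n).hom ≫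
          (PreservesCokernel.iso (Scheme.Modules.pullback (f n)) (u.app n)).hom =
        (Scheme.Modules.pullback (f n)).map (E'.iso n).hom ≫
          cokernel.π ((Scheme.Modules.pullback (f n)).map (u.app n)) := by
      rw [← CategoryTheory.Functor.map_comp_assoc, ck, CategoryTheory.Functor.map_comp_assoc,
        PreservesCokernel.π_iso_hom]
    -- (stated with the structure isomorphisms of the base changes unfolded, `baseChange_obj_iso`)
    have rhs : (Scheme.Modules.pullback (t' n)).map
          ((Scheme.Modules.pullback (f (n + 1))).map (cokernel.π (u.app (n + 1)))) ≫
        ((baseChangeIsoApp f hf n (cokernel (u.app (n + 1)))).hom ≫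
          (Scheme.Modules.pullback (f n)).map ((cokernelObj u).iso n).hom) ≫
          (PreservesCokernel.iso (Scheme.Modules.pullback (f n)) (u.app n)).hom =
        ((baseChangeIsoApp f hf n (E'.obj (n + 1))).hom ≫
          (Scheme.Modules.pullback (f n)).map (E'.iso n).hom) ≫
          cokernel.π ((Scheme.Modules.pullback (f n)).map (u.app n)) := by
      rw [Category.assoc, Category.assoc, baseChangeIsoApp_naturality_assoc, key]
    exact lhs.trans rhs.symm

/-- Level `n` of `baseChangeCokernelIsoCokernelObj` is the cokernel comparison isomorphism of
`f_n^*` (by `rfl`). [folklore] -/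
theorem baseChangeCokernelIsoCokernelObj_hom_app (n : ℕ) :
    (baseChangeCokernelIsoCokernelObj f hf u).hom.app n =
      (PreservesCokernel.iso (Scheme.Modules.pullback (f n)) (u.app n)).hom := rfl

/-- **Base change commutes with cokernels: `f^*(Coker u) ≅ Coker(f^* u)`** in `((Y'_n)_n-Mod)`
(composite of `baseChangeCokernelIsoCokernelObj` with the identifications of the chosen cokernels
with the level-wise ones). [cite: GortzWedhorn2023, Remark 24.92 (p. 565) and Construction 24.104 (p. 571)] -/
def baseChangeCokernelIso :
    (baseChange f hf).obj (cokernel u) ≅ cokernel ((baseChange f hf).map u) :=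
  (baseChange f hf).mapIso (cokernelIsoCokernelObj u) ≪≫ baseChangeCokernelIsoCokernelObj f hf u ≪≫
    (cokernelIsoCokernelObj ((baseChange f hf).map u)).symm

end Cokernel

/-! ### Base change of a formal completion, level by level -/

section Completion

variable {X X' : Scheme.{u}} (g : X' ⟶ X) (i : ∀ n, Y n ⟶ X) (w : ∀ n, t n ≫ i (n + 1) = i n)
  (i' : ∀ n, Y' n ⟶ X') (w' : ∀ n, t' n ≫ i' (n + 1) = i' n)
  (hg : ∀ n, i' n ≫ g = f n ≫ i n)

/-- **`f^*(ℱ_{/Z})` and `(g^*ℱ)_{/Z'}` agree level by level**: for a commutative square of towers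
under `g : X' ⟶ X` (`i' n ≫ g = f n ≫ i n`), `f_n^* i_n^* ℱ ≅ (f n ≫ i n)^* ℱ = (i' n ≫ g)^* ℱ ≅
i'_n{}^* g^* ℱ` (pseudofunctoriality of inverse images). This is GW's "`π^*(ℱ_{/Z}) = (π^*ℱ)_{/Z'}`"
(Constr. 24.104) on each level; the compatibility of these isomorphisms with the structure
isomorphisms (an isomorphism of modules over the tower `(Y'_n)_n`) needs the associativity
coherence of `pullbackComp` and is not asserted here — level-wise isomorphisms suffice for
level-wise properties such as local freeness (`IsVectorBundle`) and for level-wise (`Nonempty`)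
comparison statements. [cite: GortzWedhorn2023, Construction 24.104 (p. 571)] -/
def baseChangeCompletionObjIso (F : X.Modules) (n : ℕ) :
    ((baseChange f hf).obj ((completion i w).obj F)).obj n ≅
      ((completion i' w').obj ((Scheme.Modules.pullback g).obj F)).obj n :=
  (Scheme.Modules.pullbackComp (f n) (i n)).app F ≪≫ (Scheme.Modules.pullbackCongr (hg n).symm).app F ≪≫
    (Scheme.Modules.pullbackComp (i' n) g).symm.app F

include hg in
/-- Level-wise, the base change of a formal completion is the formal completion of the inverse
image (`Nonempty` form of `baseChangeCompletionObjIso`). [cite: GortzWedhorn2023, Construction 24.104 (p. 571)] -/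
theorem nonempty_baseChange_completion_obj_iso (F : X.Modules) (n : ℕ) :
    Nonempty (((baseChange f hf).obj ((completion i w).obj F)).obj n ≅
      ((completion i' w').obj ((Scheme.Modules.pullback g).obj F)).obj n) :=
  ⟨baseChangeCompletionObjIso f hf g i w i' w' hg F n⟩

end Completion

end TowerModule

end Literature.AlgebraicGeometry.FormalGeometry

end
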